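import Mathlib
import Summits.ValiantsHypothesis.ValiantsHypothesis.Theorems.LacunarySymmetroidMatrixDescartesCensusDefs

/-!
# Tower graft line — TOWERS ARE DISSOCIATED, and TowerB sits below Conjecture B (by name)

Bookkeeping piece for LINE (B) `Cruxes/WeakLifting/Lines/tower_graft.lean` (rev 9; crux `WeakLifting` = stmt-ValiantsHypothesis-19561,
restricted sub-case `TowerWeakLifting`).  NO registered stub is closed.  The line's vocabulary has `IsTower m d` (`m·dₗ < d_{l'}` for
`l < l'`) and `IsDissociated m d` (distinct class-count vectors of total `m` give distinct exponents `Σ nₗ·dₗ`); its docstring asserts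
«towers are dissociated», and its heads give `KPlusLogSqLaw ⟺ DissociatedB` (p650155) and `TowerB ⟹ TowerWeakLifting`.  This file
supplies the two missing one-liners of that picture, def-free (line defs inlined verbatim):

* `tower_init_sum_lt`, `tower_classSum_injective` / `isDissociated_of_isTower` — **towers are dissociated**: on an `m`-tower distinct
  class-count vectors of total `m` have distinct exponents (unique digit expansion; induction on the number of letters, peeling the top
  letter: below it a count vector of total `≤ m` weighs `< d_top`).
* `multiset_map_sum_eq_sum_count`, `card_image_sumExp_eq` — hence the `s`-fold sumset of an `s`-tower has EXACTLY `C(K+s−1, s)` exponents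
  (equality case of `card_image_sumExp_le` in `…TowerGraftMinorPencil`; the count used in the support-level-T5 refutation, evidence memo
  #59 on stmt-19561): the sums factor through `Sym (Fin K) s` (onto) and the multiset is recovered from its weight (towers dissociated).
* `towerB_of_dissociatedB` — `DissociatedB → TowerB`; `towerB_of_kPlusLogSqLaw` — `KPlusLogSqLaw → TowerB` (positive roots ≤ all roots;
  the tower hypothesis is not even used).  HONEST TRIANGLE: `TowerWeakLifting ⟸ TowerB ⟸ DissociatedB ⟺ KPlusLogSqLaw` — the line's
  restricted target is a CONSEQUENCE of Conjecture B; nothing here goes the other way.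

Def-free; Mathlib + the census vocabulary file.  Proves no stub and nothing about `WeakLifting`, Conjecture B / `KPlusLogSqLaw` itself,
`MatrixDescartes` (18050) or `VP ≠ VNP`.  Seat: prover val-sym-lift-p3 g17, `--supports stmt-ValiantsHypothesis-19561`.
-/

-- `Summit.ValiantsHypothesis.ValiantsHypothesis.…` repeats a component by the D-0017 layout
-- (single-conjunct summit), which the `dupNamespace` linter flags; the name is mandated.
set_option linter.dupNamespace false

namespace Summit.ValiantsHypothesis.ValiantsHypothesis.Theorems.KPlusLogSqLaw.TowerGraft

open Finset
open scoped BigOperators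
open Summit.ValiantsHypothesis.ValiantsHypothesis.Theorems.LacunarySymmetroidMatrixDescartes (PosRootLawOn KPlusLogSqLaw)

/-- the digit estimate: below the top letter of an `m`-tower, a class-count vector of total `≤ m` (`m ≥ 1`) weighs less than the
top exponent. [folklore] -/
theorem tower_init_sum_lt {K m : ℕ} (d : Fin (K + 1) → ℕ) (hd : ∀ l l' : Fin (K + 1), l < l' → m * d l < d l')
    (hK : 0 < K) (hm : 0 < m) (p : Fin K → ℕ) (hp : ∑ l, p l ≤ m) :
    ∑ l : Fin K, p l * d l.castSucc < d (Fin.last K) := by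
  have htop : ∀ l : Fin K, m * d l.castSucc ≤ d (Fin.last K) - 1 := fun l =>
    Nat.le_sub_one_of_lt (hd l.castSucc (Fin.last K) (Fin.castSucc_lt_last l))
  have hpos : 1 ≤ d (Fin.last K) := by
    have h := hd (Fin.castSucc ⟨0, hK⟩) (Fin.last K) (Fin.castSucc_lt_last _)
    omega
  have h1 : m * ∑ l : Fin K, p l * d l.castSucc ≤ m * (d (Fin.last K) - 1) := by
    calc m * ∑ l : Fin K, p l * d l.castSucc = ∑ l : Fin K, p l * (m * d l.castSucc) := by
          rw [Finset.mul_sum]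
          exact Finset.sum_congr rfl fun l _ => by ring
      _ ≤ ∑ l : Fin K, p l * (d (Fin.last K) - 1) := Finset.sum_le_sum fun l _ => Nat.mul_le_mul_left _ (htop l)
      _ = (∑ l : Fin K, p l) * (d (Fin.last K) - 1) := by rw [Finset.sum_mul]
      _ ≤ m * (d (Fin.last K) - 1) := Nat.mul_le_mul_right _ hp
  have h2 := Nat.le_of_mul_le_mul_left h1 hm
  omega

/-- **TOWERS ARE DISSOCIATED**: on an `m`-tower `d` (`m·dₗ < d_{l'}` for `l < l'`) distinct class-count vectors of total `m` have distinct
exponents `Σ nₗ·dₗ` (unique digit expansion; induction on the number of letters, peeling the top one). [folklore] -/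
theorem tower_classSum_injective : ∀ (K m : ℕ) (d : Fin K → ℕ), (∀ l l' : Fin K, l < l' → m * d l < d l') →
    ∀ n n' : Fin K → ℕ, ∑ l, n l = m → ∑ l, n' l = m → ∑ l, n l * d l = ∑ l, n' l * d l → n = n' := by
  intro K
  induction K with
  | zero => intro m d _ n n' _ _ _; funext l; exact Fin.elim0 l
  | succ K ih =>
    intro m d hd n n' hn hn' he
    simp only [Fin.sum_univ_castSucc] at hn hn' he
    -- key: if the top counts differ, the exponents differ
    have key : ∀ p p' : Fin (K + 1) → ℕ, (∑ l : Fin K, p l.castSucc) + p (Fin.last K) = m →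
        (∑ l : Fin K, p' l.castSucc) + p' (Fin.last K) = m → p (Fin.last K) < p' (Fin.last K) →
        (∑ l : Fin K, p l.castSucc * d l.castSucc) + p (Fin.last K) * d (Fin.last K) <
          (∑ l : Fin K, p' l.castSucc * d l.castSucc) + p' (Fin.last K) * d (Fin.last K) := by
      intro p p' hp hp' hlt
      have hm : 0 < m := by omega
      rcases Nat.eq_zero_or_pos K with hK | hK
      · subst hK
        simp only [Finset.univ_eq_empty, Finset.sum_empty, zero_add] at hp hp' ⊢
        omega
      have hlow := tower_init_sum_lt d hd hK hm (fun l => p l.castSucc) (by omega)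
      calc (∑ l : Fin K, p l.castSucc * d l.castSucc) + p (Fin.last K) * d (Fin.last K)
          < d (Fin.last K) + p (Fin.last K) * d (Fin.last K) := Nat.add_lt_add_right hlow _
        _ = (p (Fin.last K) + 1) * d (Fin.last K) := by ring
        _ ≤ p' (Fin.last K) * d (Fin.last K) := Nat.mul_le_mul_right _ hlt
        _ ≤ (∑ l : Fin K, p' l.castSucc * d l.castSucc) + p' (Fin.last K) * d (Fin.last K) := Nat.le_add_left _ _
    rcases lt_trichotomy (n (Fin.last K)) (n' (Fin.last K)) with hlt | heq | hgt
    · exact absurd he (ne_of_lt (key n n' hn hn' hlt))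
    · -- equal top counts: induct on the lower letters with the smaller class total
      have hsum : ∑ l : Fin K, n l.castSucc = m - n (Fin.last K) := by omega
      have hsum' : ∑ l : Fin K, n' l.castSucc = m - n (Fin.last K) := by omega
      have he' : ∑ l : Fin K, n l.castSucc * d l.castSucc = ∑ l : Fin K, n' l.castSucc * d l.castSucc := by
        rw [heq] at he
        omega
      have hd' : ∀ l l' : Fin K, l < l' → (m - n (Fin.last K)) * d l.castSucc < d l'.castSucc := fun l l' hll' =>
        lt_of_le_of_lt (Nat.mul_le_mul_right _ (Nat.sub_le _ _)) (hd _ _ (Fin.castSucc_lt_castSucc_iff.mpr hll'))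
      have hinit := ih (m - n (Fin.last K)) (fun l => d l.castSucc) hd' (fun l => n l.castSucc) (fun l => n' l.castSucc)
        hsum hsum' he'
      funext l
      refine Fin.lastCases ?_ (fun i => ?_) l
      · exact heq
      · exact congrFun hinit i
    · exact absurd he.symm (ne_of_lt (key n' n hn' hn hgt))

/-- the line's form: `IsTower m d → IsDissociated m d` (both inlined). [folklore] -/
theorem isDissociated_of_isTower {m K : ℕ} {d : Fin K → ℕ} (hd : ∀ l l' : Fin K, l < l' → m * d l < d l') :
    ∀ n n' : Fin K → ℕ, ∑ l, n l = m → ∑ l, n' l = m → ∑ l, n l * d l = ∑ l, n' l * d l → n = n' :=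
  tower_classSum_injective K m d hd

/-- **TowerB is a CONSEQUENCE of DissociatedB** (hence, by `kPlusLogSqLaw_iff_dissociatedB`, of Conjecture B): the line's target
`TowerWeakLifting ⟸ TowerB ⟸ DissociatedB ⟺ KPlusLogSqLaw` — TowerB (and the whole line) sits BELOW B, as the line card says; the
defs `DissociatedB`, `TowerB`, `IsDissociated`, `IsTower` are inlined verbatim. [this work] -/
theorem towerB_of_dissociatedB
    (hDB : ∃ C : ℕ, ∀ (m K : ℕ) (d : Fin K → ℕ),
      (∀ n n' : Fin K → ℕ, ∑ l, n l = m → ∑ l, n' l = m → ∑ l, n l * d l = ∑ l, n' l * d l → n = n') →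
        PosRootLawOn m K (2 ^ (C * (K + Nat.log 2 m ^ 2))) d) :
    ∃ C : ℕ, ∀ (m K : ℕ) (d : Fin K → ℕ), (∀ l l' : Fin K, l < l' → m * d l < d l') →
      PosRootLawOn m K (2 ^ (C * (K + Nat.log 2 m ^ 2))) d := by
  obtain ⟨C, hC⟩ := hDB
  exact ⟨C, fun m K d hd => hC m K d (isDissociated_of_isTower hd)⟩

/-! ### The sumset count with equality -/

/-- a multiset's `d`-weight is the class-count combination `Σₗ (count l)·dₗ`. [folklore] -/
theorem multiset_map_sum_eq_sum_count {K : ℕ} (d : Fin K → ℕ) (μ : Multiset (Fin K)) :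
    (μ.map d).sum = ∑ l, μ.count l * d l := by
  classical
  rw [Finset.sum_multiset_map_count]
  rw [Finset.sum_subset (Finset.subset_univ μ.toFinset)]
  · rfl
  · intro l _ hl
    rw [Multiset.mem_toFinset] at hl
    rw [Multiset.count_eq_zero_of_notMem hl, zero_smul]

/-- **THE SUMSET OF A TOWER HAS EXACTLY `C(K+s−1, s)` EXPONENTS**: on an `s`-tower the `s`-fold sums `Σ_a d (f a)`, `f : Fin s → Fin K`,
take exactly `C(K+s−1, s)` values (they factor through the multiset of values of `f`, a point of `Sym (Fin K) s` — stars and bars — and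
the multiset is recovered from the sum by `tower_classSum_injective`).  Equality case of `card_image_sumExp_le` (`…TowerGraftMinorPencil`).
[this work] -/
theorem card_image_sumExp_eq {K s : ℕ} (d : Fin K → ℕ) (hd : ∀ l l' : Fin K, l < l' → s * d l < d l') :
    (Finset.univ.image fun f : Fin s → Fin K => ∑ a, d (f a)).card = Nat.choose (K + s - 1) s := by
  classical
  -- the two maps: functions → multisets of values → weights
  set φ : (Fin s → Fin K) → Sym (Fin K) s := fun f => ⟨Finset.univ.val.map f, by simp⟩ with hφ
  set ψ : Sym (Fin K) s → ℕ := fun σ => ((σ : Multiset (Fin K)).map d).sum with hψ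
  have hfac : ∀ f : Fin s → Fin K, (∑ a, d (f a)) = ψ (φ f) := by
    intro f
    simp only [hψ, hφ, Sym.coe_mk]
    rw [Finset.sum_eq_multiset_sum, Multiset.map_map]
    rfl
  -- φ is onto
  have hsurj : Function.Surjective φ := by
    intro σ
    set l : List (Fin K) := (σ : Multiset (Fin K)).toList with hldef
    have hl : (l : Multiset (Fin K)) = (σ : Multiset (Fin K)) := Multiset.coe_toList _
    have hlen : l.length = s := by rw [hldef, Multiset.length_toList, Sym.card_coe]
    refine ⟨fun i => l.get (Fin.cast hlen.symm i), Sym.ext ?_⟩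
    show Finset.univ.val.map (fun i => l.get (Fin.cast hlen.symm i)) = (σ : Multiset (Fin K))
    rw [Fin.univ_val_map, ← hl, ← List.ofFn_congr hlen l.get, List.ofFn_get]
  -- ψ is injective on a tower
  have hinj : Function.Injective ψ := by
    intro σ τ hστ
    have hσs : ∑ l, (σ : Multiset (Fin K)).count l = s := by
      rw [Multiset.sum_count_eq_card (fun _ _ => Finset.mem_univ _)]; exact σ.2
    have hτs : ∑ l, (τ : Multiset (Fin K)).count l = s := by
      rw [Multiset.sum_count_eq_card (fun _ _ => Finset.mem_univ _)]; exact τ.2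
    have hw : ∑ l, (σ : Multiset (Fin K)).count l * d l = ∑ l, (τ : Multiset (Fin K)).count l * d l := by
      rw [← multiset_map_sum_eq_sum_count, ← multiset_map_sum_eq_sum_count]
      exact hστ
    have hcount := tower_classSum_injective K s d hd _ _ hσs hτs hw
    exact Subtype.ext (Multiset.ext.mpr fun l => congrFun hcount l)
  -- count
  have himage : (Finset.univ.image fun f : Fin s → Fin K => ∑ a, d (f a)) = Finset.univ.image ψ := by
    ext x
    simp only [Finset.mem_image, Finset.mem_univ, true_and]
    constructor
    · rintro ⟨f, rfl⟩
      exact ⟨φ f, (hfac f).symm⟩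
    · rintro ⟨σ, rfl⟩
      obtain ⟨f, rfl⟩ := hsurj σ
      exact ⟨f, hfac f⟩
  rw [himage, Finset.card_image_of_injective _ hinj, Finset.card_univ, Sym.card_sym_eq_choose, Fintype.card_fin]

/-- **TowerB is a CONSEQUENCE of Conjecture B** directly (`KPlusLogSqLaw`, all-real-roots rows on every support ⇒ the positive-root row on
every support; the tower hypothesis is not used): the line's `TowerB`, inlined verbatim. [this work] -/
theorem towerB_of_kPlusLogSqLaw (hB : KPlusLogSqLaw) :
    ∃ C : ℕ, ∀ (m K : ℕ) (d : Fin K → ℕ), (∀ l l' : Fin K, l < l' → m * d l < d l') →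
      PosRootLawOn m K (2 ^ (C * (K + Nat.log 2 m ^ 2))) d := by
  obtain ⟨C, hC⟩ := hB
  exact ⟨C, fun m K d _ S hS => (Finset.card_filter_le _ _).trans (hC m K d S hS)⟩

end Summit.ValiantsHypothesis.ValiantsHypothesis.Theorems.KPlusLogSqLaw.TowerGraft
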